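import Literature.AnabelianGeometry.EtaleTheta.TemperedFrobenioidOfThetaTwistTower

/-!
# [EtTh] Def. 3.3 (iii) / Def. 3.6 (i) at the ε-free `(β)` theta tower PULLED BACK ALONG A GROUP HOMOMORPHISM `ψ : Γ → Compat₃′`:
# the level-`n` Galois actions `(towerC₃sf.act n).comap ψ` on `Γ`-sets — constants, `div₀`, the ramified uniformiser (Def. 3.3 p.299,
# Def. 3.6 p.303 / PDF pp.73, 77)

S. Mochizuki, *The étale theta function …*, Publ. RIMS **45** (2009) [MochizukiEtTh2009], Def. 3.3 (iii) pp.299–300 (PDF pp.73–74)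
(`Φ₀`, `B₀` of a covering), Prop. 3.4 p.300 (PDF p.74), Def. 3.6 (i) p.303 (PDF p.77); §1 p.239 (PDF p.13) (`K_N`, the uniformiser).
[cite: MochizukiEtTh2009, Def 3.3 (iii) p.299 (PDF p.73)]  PAGE CONVENTION for [EtTh]: «printed N (PDF p.M)», N = M + 226.

abc-iut cell, layer L2, seat abc-iut-L2-t3 (gen 10; [EtTh] §3/§4 lineage, `LogDivisorTower` / `towerC₃sf` owner), lane «(β2)-PREP: COMAP LEVEL-n KIT»
of the S2-repair of record (abc-iut-L2-lead R1257: (α) «DENSE-QUOTIENT» p504894; (β1) «COMAP-TOWER generic» abc-iut-L2-t2; (β2) fourth-model twin over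
a closed subgroup).  ADDITIVE and (β1)-INDEPENDENT: nothing landed is edited; no `LevelSystem` / `LogDivisorTower` packaging is used — only abc-iut-w6-d058's
`GaloisAction.comap` (p457919) of the level-`n` action of abc-iut-L2-d2's FILE 4 (p493549), whose §2 lemmas are consumed BY NAME at `ψ g`.
WHY.  The junction carrier a genuine `φ : Π^tp_X̲̲ → Compat₃′` can enter is a tower model over `B^temp(G)⁰` for the CLOSED subgroup
`G := closure(Im φ) ≤ Compat₃′` ((α), `mkOfClosureRange`); its Def. 3.6 (i) data at level `n` are the FILE-4 data with `Γ := G` acting through the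
inclusion.  This file proves, for ANY `ψ : Γ →* Compat₃′` and ANY `Γ`-set `S`, every level-`n` ingredient of the `PowDiagonalBase` of FILE 4 / p501267:
* `phiZero_comap_eq` (`rfl`): `Φ₀` of the pulled-back action IS the `Ÿ`-skeleton's `Φ₀` through `φ₃ ∘ ψ` — so abc-iut-L2-t3's ENTIRE `TateTowerTheta`
  calculus (`coord`, `diag`, `coord_separating`, `thetaZerosPhi`, `perfection_map_coprime`, …; generic in `(Γ, φ)`) applies verbatim at `φ := φ₃ ∘ ψ`;
* `toAdd_snd_actFn_comap`, **`toAdd_snd_apply_eq_of_mem_fZero_comap`** (on a connected `Γ`-set an element of `F₀(S)` has CONSTANT skeleton part),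
  **`divZeroHom_eq_diag_zpow_comap`**, **`divZeroHom_mem_zpowers_of_mem_fZero_comap`** (`Φ₀^cnst(S) ⊆ ⟨[diag]⟩`);
* **`unifPowFamComap`** — the ramified uniformiser `ϖ = ϖ̈_n^{N_n}` as a `Γ`-invariant family in `B₀(S)` (FILE 4's `actFn_unifPow` at `ψ g`), in
  `F₀(S)`, with **`div₀ ϖ = [diag]^{N_n}`**;
* the dictionary at `ψ := id`: the kit's statements ARE FILE 4's (`comap (MonoidHom.id _)` acts as `towerC₃sf.act n`, `actFn_comap_id`).
NOT HERE ((β1)/(β2) proper): the transition fields `hΦinj`/`hΦrefl` and `ofTower` of the pulled-back TOWER (`LogDivisorTower.comap`, abc-iut-L2-t2), the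
E2 root law over `B^temp(G)⁰`, the tempered Frobenioid and the §4 socket.  HONEST FRAMING: class-(b) combinatorial design carrier (NOT the tempered
Frobenioid of a Tate curve); [EtTh] is a refereed prerequisite paper; nothing here bears on [IUTchIII] Cor. 3.12 or asserts abc proved/refuted; typed ≠ proved.
-/

noncomputable section

namespace Literature.AnabelianGeometry.EtaleTheta

open CategoryTheory Opposite Function Literature.AlgebraicGeometry.Frobenioids Literature.AnabelianGeometry.SemiGraphs
  LogDivisorModel LogDivisorModel.GaloisAction LogDivisorTower TateTowerKummerTwistRShear LogDivisorModel.TateTowerThetaTwist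

namespace ThetaTwistTowerTempered

open TateTowerKummerTwist (N N_dvd_M)

variable {Γ : Type} [Group Γ] (ψ : Γ →* Compat 3 thetaShear) (n : ℕ) {S : Action (Type 0) Γ}

/-! ## §1 The pulled-back level-`n` action: `Φ₀` is the skeleton's through `φ₃ ∘ ψ` -/

/-- **KEY IDENTITY (definitional)**: `Φ₀` of the level-`n` action pulled back along `ψ`, on any `Γ`-set, IS the `Ÿ`-skeleton's `Φ₀` for `Γ`
acting through the translation character `φ₃ ∘ ψ`. [cite: MochizukiEtTh2009, Def 3.3 (iii) p.299 (PDF p.73)] -/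
theorem phiZero_comap_eq (S : Action (Type 0) Γ) :
    ((towerC₃sf.act n).comap ψ).phiZero S = (TateTowerTheta.action (φ₃.comp ψ)).phiZero S := rfl

/-- The pulled-back action on functions is FILE 4's at `ψ g` (definitionally). [cite: MochizukiEtTh2009, Def 3.3 (iii) p.299 (PDF p.73)] -/
theorem actFn_comap (g : Γ) (x : (towerC₃sf.Z n).Fn) : ((towerC₃sf.act n).comap ψ).actFn g x = (towerC₃sf.act n).actFn (ψ g) x := rfl

/-- DICTIONARY at `ψ := id`: the pulled-back action on functions is `towerC₃sf.act n` itself. [cite: MochizukiEtTh2009, Def 3.3 (iii) p.299 (PDF p.73)] -/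
theorem actFn_comap_id (g : Compat 3 thetaShear) (x : (towerC₃sf.Z n).Fn) :
    ((towerC₃sf.act n).comap (MonoidHom.id _)).actFn g x = (towerC₃sf.act n).actFn g x := rfl

/-- The skeleton part of `g · x` is the sign-free shear by `φ₃(ψ g)` of the skeleton part of `x`. [cite: MochizukiEtTh2009, Def 3.3 (iii) p.299 (PDF p.73)] -/
theorem toAdd_snd_actFn_comap (g : Γ) (x : (towerC₃sf.Z n).Fn) :
    Multiplicative.toAdd (((towerC₃sf.act n).comap ψ).actFn g x).1.2 =
      shear₀ (Multiplicative.toAdd ((φ₃.comp ψ) g)) (Multiplicative.toAdd x.1.2) :=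
  toAdd_snd_actFn n (ψ g) x

/-! ## §2 Constants on a connected `Γ`-set: constant skeleton part, `div₀ = [diag]^c` -/

/-- **On a CONNECTED `Γ`-set `S`, an element of `F₀(S)` has CONSTANT skeleton part `ϖ̈_n^c`** (FILE 4's argument at `ψ g`).
[cite: MochizukiEtTh2009, Prop 3.4 p.300 (PDF p.74)] -/
theorem toAdd_snd_apply_eq_of_mem_fZero_comap (hS : isConnectedGSet S) (s₀ : S.V) {b : ((towerC₃sf.act n).comap ψ).bZero S}
    (hb : b ∈ ((towerC₃sf.act n).comap ψ).fZero S) (s : S.V) :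
    Multiplicative.toAdd (b.1 s).1.2 =
      (((0 : ZMod 2), TateTowerTheta.eC (Multiplicative.toAdd (b.1 s₀).1.2), (0 : ℤ), (0 : ℤ)) : TateTowerTheta.Exp) := by
  have hc : ∀ t : S.V, TateTowerTheta.eU (Multiplicative.toAdd (b.1 t).1.2) = 0 ∧
      TateTowerTheta.eT (Multiplicative.toAdd (b.1 t).1.2) = 0 := fun t => hb t
  have h0 : Multiplicative.toAdd (b.1 s₀).1.2 =
      (((0 : ZMod 2), TateTowerTheta.eC (Multiplicative.toAdd (b.1 s₀).1.2), (0 : ℤ), (0 : ℤ)) : TateTowerTheta.Exp) :=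
    TateTowerTheta.ext_exp (b.1 s₀).2 rfl (hc s₀).1 (hc s₀).2
  obtain ⟨g, rfl⟩ := ((isConnectedGSet_iff S).1 hS).2 s₀ s
  have e1 : Multiplicative.toAdd (b.1 (S.ρ g s₀)).1.2 =
      shear₀ (Multiplicative.toAdd ((φ₃.comp ψ) g)) (Multiplicative.toAdd (b.1 s₀).1.2) :=
    (congrArg (fun f : (towerC₃sf.Z n).Fn => Multiplicative.toAdd f.1.2) (b.2.2 g s₀)).trans (toAdd_snd_actFn_comap ψ n g _)
  exact e1.trans ((shear₀_eq_self_of_const _ (hc s₀).1 (hc s₀).2).trans h0)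

/-- **`div₀` of an element of `B₀(S)` with constant skeleton part `ϖ̈_n^c` is `[diag]^c`** for the pulled-back action (the diagonal of the
`Ÿ`-skeleton at `φ := φ₃ ∘ ψ`). [cite: MochizukiEtTh2009, Def 3.3 (iii) p.299 (PDF p.73)] -/
theorem divZeroHom_eq_diag_zpow_comap {b : ((towerC₃sf.act n).comap ψ).bZero S} {c : ℤ}
    (hb : ∀ s, Multiplicative.toAdd (b.1 s).1.2 = (((0 : ZMod 2), c, (0 : ℤ), (0 : ℤ)) : TateTowerTheta.Exp)) :
    ((towerC₃sf.act n).comap ψ).divZeroHom S b = Algebra.GrothendieckGroup.of (TateTowerTheta.diag (φ₃.comp ψ) S) ^ c := by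
  have hdiv : ∀ (s : S.V) (x : TateTowerTheta.Idx),
      TateTowerTheta.mlt (((towerC₃sf.act n).comap ψ).divAt S b s) x = c * TateTowerTheta.mlt TateTowerTheta.ones x := fun s x => by
    have e : TateTowerTheta.divFun (((0 : ZMod 2), c, (0 : ℤ), (0 : ℤ)) : TateTowerTheta.Exp) x =
        c * TateTowerTheta.mlt TateTowerTheta.ones x := by
      rcases x with d | j
      · simp [TateTowerTheta.eT, TateTowerTheta.mlt_ones]
      · simp [TateTowerTheta.eC, TateTowerTheta.eU, TateTowerTheta.eT, TateTowerTheta.mlt_ones]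
    exact (congrArg (TateTowerTheta.divFun · x) (hb s)).trans e
  have h : ((towerC₃sf.act n).comap ψ).divZeroHom S b = Algebra.GrothendieckGroup.of (TateTowerTheta.diag (φ₃.comp ψ) S ^ c.toNat) /
      Algebra.GrothendieckGroup.of (TateTowerTheta.diag (φ₃.comp ψ) S ^ (-c).toNat) :=
    (((towerC₃sf.act n).comap ψ).divZeroHom_eq_div_iff S _ _ _).2 fun s => TateTowerTheta.ext_mlt fun x => by
      change TateTowerTheta.mlt (((towerC₃sf.act n).comap ψ).divAt S b s) x + TateTowerTheta.mlt (TateTowerTheta.ones ^ (-c).toNat) x =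
        TateTowerTheta.mlt (TateTowerTheta.ones ^ c.toNat) x
      rw [hdiv, TateTowerTheta.mlt_pow, TateTowerTheta.mlt_pow, ← add_mul]
      congr 1
      omega
  refine h.trans ?_
  rw [map_pow, map_pow, div_eq_mul_inv, ← zpow_natCast, ← zpow_natCast, ← zpow_neg, ← zpow_add]
  congr 1
  omega

/-- **`Φ₀^cnst(S)` lies in the cyclic group of the diagonal** (connected `Γ`-set `S`) for the pulled-back action — the `div₀_mem_zpowers` field of the
(β2) diagonal base data. [cite: MochizukiEtTh2009, Def 3.6 p.303 (PDF p.77)] -/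
theorem divZeroHom_mem_zpowers_of_mem_fZero_comap (hS : isConnectedGSet S) {b : ((towerC₃sf.act n).comap ψ).bZero S}
    (hb : b ∈ ((towerC₃sf.act n).comap ψ).fZero S) :
    ((towerC₃sf.act n).comap ψ).divZeroHom S b ∈ Subgroup.zpowers (Algebra.GrothendieckGroup.of (TateTowerTheta.diag (φ₃.comp ψ) S)) := by
  obtain ⟨s₀⟩ := ((isConnectedGSet_iff S).1 hS).1
  rw [divZeroHom_eq_diag_zpow_comap ψ n (toAdd_snd_apply_eq_of_mem_fZero_comap ψ n hS s₀ hb)]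
  exact ⟨_, rfl⟩

/-! ## §3 The ramified uniformiser `ϖ` as a `Γ`-invariant family -/

/-- **The constant family `ϖ = ϖ̈_n^{N_n}` on any `Γ`-set `S`**, an element of `B₀(S)` for the pulled-back level-`n` action (`ϖ` is fixed by the
whole of «GRP₃′», FILE 4's `actFn_unifPow`, a fortiori by `ψ(Γ)`). [cite: MochizukiEtTh2009, §1 p.239 (PDF p.13)] -/
def unifPowFamComap (S : Action (Type 0) Γ) : ((towerC₃sf.act n).comap ψ).bZero S :=
  ⟨fun _ => unifPow n, fun _ => trivial, fun g _ => (actFn_unifPow n (ψ g)).symm⟩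

/-- The family is constant with value `ϖ` (definitionally). [cite: MochizukiEtTh2009, §1 p.239 (PDF p.13)] -/
@[simp] theorem unifPowFamComap_apply (S : Action (Type 0) Γ) (s : S.V) : (unifPowFamComap ψ n S).1 s = unifPow n := rfl

/-- `ϖ ∈ F₀(S)`. [cite: MochizukiEtTh2009, Def 3.3 (iii) p.299 (PDF p.73)] -/
theorem unifPowFamComap_mem_fZero (S : Action (Type 0) Γ) : unifPowFamComap ψ n S ∈ ((towerC₃sf.act n).comap ψ).fZero S :=
  fun _ => show TateTowerTheta.eU _ = 0 ∧ TateTowerTheta.eT _ = 0 from ⟨rfl, rfl⟩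

/-- **`div₀ ϖ = [diag]^{N_n}`** at level `n` for the pulled-back action — the uniformiser is RAMIFIED of index `N_n = (n+1)!` over the reduced special
fibre (the `exists_div₀_eq_pow` field of the (β2) diagonal base data, exponent `N_n ≥ 1`). [cite: MochizukiEtTh2009, Def 3.3 (iii) p.300 (PDF p.74)] -/
theorem divZeroHom_unifPowFamComap (S : Action (Type 0) Γ) :
    ((towerC₃sf.act n).comap ψ).divZeroHom S (unifPowFamComap ψ n S) =
      Algebra.GrothendieckGroup.of (TateTowerTheta.diag (φ₃.comp ψ) S) ^ ((N n : ℕ) : ℤ) :=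
  divZeroHom_eq_diag_zpow_comap ψ n fun _ => rfl

/-- The same with a natural-number exponent (the shape `∃ k > 0, div₀ ϖ = [diag]^k` of `PowDiagonalBase.exists_div₀_eq_pow`).
[cite: MochizukiEtTh2009, Def 3.6 p.303 (PDF p.77)] -/
theorem exists_divZeroHom_eq_diag_pow_comap (S : Action (Type 0) Γ) :
    ∃ b ∈ ((towerC₃sf.act n).comap ψ).fZero S, ∃ k : ℕ, 0 < k ∧
      ((towerC₃sf.act n).comap ψ).divZeroHom S b = Algebra.GrothendieckGroup.of (TateTowerTheta.diag (φ₃.comp ψ) S) ^ (k : ℤ) :=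
  ⟨unifPowFamComap ψ n S, unifPowFamComap_mem_fZero ψ n S, (N n : ℕ), PNat.pos _, divZeroHom_unifPowFamComap ψ n S⟩

/-! ## §4 Prop. 3.4 (i) and the class of `Θ̈`'s zeros for the pulled-back action -/

/-- **Prop. 3.4 (i) (weak, cofinal perfection) for `Φ₀(S)` of the pulled-back action** (abc-iut-w6-d057's generic theorem).
[cite: MochizukiEtTh2009, Prop 3.4 p.300 (PDF p.74)] -/
theorem isPerfFactorialCof_phiZero_comap (S : Action (Type 0) Γ) : IsPerfFactorialCof (((towerC₃sf.act n).comap ψ).phiZero S) :=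
  LogDivisorModel.GaloisAction.isPerfFactorialCof_phiZero _ _

/-- **The zero divisor of `Θ̈` is an element of `Φ₀(S)` for the pulled-back action on EVERY `Γ`-set, distinct from every power of the diagonal at
every positive exponent** (abc-iut-L2-t3's `thetaZerosPhi` / `thetaZerosPhi_pow_ne_diag_pow` at `φ := φ₃ ∘ ψ`, through `phiZero_comap_eq`) — the
«`Φ^{bs-fld} ⊊ Φ`» ingredient of the (β2) model. [cite: MochizukiEtTh2009, Def 3.6 p.303 (PDF p.77)] -/
theorem thetaZerosPhi_pow_ne_diag_pow_comap (S : Action (Type 0) Γ) [Nonempty S.V] {k : ℕ} (hk : k ≠ 0) (c : ℕ) :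
    (TateTowerTheta.thetaZerosPhi (φ₃.comp ψ) S : ((towerC₃sf.act n).comap ψ).phiZero S) ^ k ≠
      TateTowerTheta.diag (φ₃.comp ψ) S ^ c :=
  TateTowerTheta.thetaZerosPhi_pow_ne_diag_pow (φ₃.comp ψ) S hk c

end ThetaTwistTowerTempered

end Literature.AnabelianGeometry.EtaleTheta

end
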